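import Summits.AtomisticToContinuum.BoseEinsteinCondensation.Theorems.LatticeODLROOffHalfFilling.Negative.OffHalfFillingCommutators

/-!
# Crux `LatticeODLROOffHalfFilling` — OFF HALF FILLING IS FORCED

Crux-disprover result for `stmt-AtomisticToContinuum-11033` (route BECGroundStateSOS), part 5c
(needs 5b `OffHalfFillingCommutators`):

* `offHalf_core` — on a torus of side `L ≥ 3`, if the `μ = 0` tracial ground state has
  `Re ω₀(Σ_{x,y} hop) ≥ c₀|Λ|²` and `c₀ μ |Λ| > 6` (`μ > 0`), then no nonzero ground vector of
  `H_{L,μ}` is half filled: a half-filled ground vector gives `E₀(μ) ≥ E₀(0)`, while the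
  Koma–Tasaki trial states built on an ordered `S³_tot`-eigen column `ψ` of `P₀(H_{L,0})`
  (`ψ`/`Uψ` if `M ≠ 0`; `S⁺_tot ψ` if `M = 0`) have energy `< E₀(0)` at chemical potential `μ`;
* `orderParam_eq_re_gsf` — the crux's `k`-th liminf term as `Re ω_{2k,μ}(Σ hop)/(2k)⁶`;
* **`offHalfFilling_forced`** — for every `μ ≠ 0` there is `L₀` such that on every even torus of
  side `L ≥ L₀`, `v ∈ groundSpace(H_{L,μ}) → S³_tot v = 0 → v = 0`: the KLS (half-filled) ground
  state never survives a fixed chemical potential; ANY PROOF OF THE CRUX MUST CONTROL GROUND STATES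
  IN SECTORS `S³_tot ≠ 0`, where site-local reflection positivity of the state is unavailable
  (`Literature.Barriers.AtomisticToContinuum.HalfFillingReflectionPositivityNarrow`).
All [folklore] (Koma–Tasaki 1994 low-lying states; Kennedy–Lieb–Shastry 1988 for the input LRO).
-/

noncomputable section

namespace Summit.AtomisticToContinuum.BoseEinsteinCondensation.Theorems.LatticeODLROOffHalfFilling.Negative

open Literature.MathematicalPhysics.QuantumLattice Literature.Probability.LatticeModels Matrix Finset
open scoped ComplexOrder BigOperators

section OffHalf

variable {Λ : Type*} [Fintype Λ] [DecidableEq Λ]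

variable (L : ℕ) [NeZero L]

/-! #### The argument -/

/-- `‖Uψ‖² = ‖ψ‖²` for `UᴴU = 1`. [folklore] -/
theorem star_mulVec_dotProduct_mulVec {U : Op Λ 2} (hU : Uᴴ * U = 1)
    (ψ : TensorIndex Λ 2 → ℂ) : star (U *ᵥ ψ) ⬝ᵥ (U *ᵥ ψ) = star ψ ⬝ᵥ ψ := by
  rw [star_mulVec, ← dotProduct_mulVec, mulVec_mulVec, hU, one_mulVec]

/-- `S³_tot U = −U S³_tot` for the flip `U`. [folklore] -/
theorem totalSpin_two_mul_flipOp :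
    (totalSpin 1 2 : Op Λ 2) * flipOp = -(flipOp * totalSpin 1 2) := by
  have h := congrArg (· * flipOp) (flip_conj_totalSpin_two (Λ := Λ))
  rw [Matrix.mul_assoc, flipOp_conjTranspose_mul, Matrix.mul_one, Matrix.neg_mul] at h
  exact (neg_eq_iff_eq_neg.mpr h).symm

/-- `U H_{L,μ} = H_{L,−μ} U` (`L ≥ 3`). [folklore] -/
theorem flipOp_mul_hmu (hL : 3 ≤ L) (μ : ℝ) : flipOp * Hmu L μ = Hmu L (-μ) * flipOp := by
  have h := congrArg (· * flipOp) (flip_conj_hmu L hL μ)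
  rwa [Matrix.mul_assoc, flipOp_conjTranspose_mul, Matrix.mul_one] at h

/-- **Core of the argument** (`μ > 0`, fixed torus of side `L ≥ 3`): if the `μ = 0` tracial ground
state has `Re ω₀(Σ_{x,y} hop) ≥ c₀|Λ|²` and `c₀ μ |Λ| > 6`, then NO nonzero ground vector of
`H_{L,μ}` is half filled (`S³_tot v = 0`). Koma–Tasaki: a half-filled ground vector would give
`E₀(μ) ≥ E₀(0)`, while the columns of `P₀(H_{L,0})` (simultaneous `S³_tot`-eigenvectors, one of
which inherits the order, `exists_col_quad_ge`) give trial states — themselves or their flips if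
`M ≠ 0`, `S⁺_tot ψ` if `M = 0` — of energy `< E₀(0)` at chemical potential `μ`
(`re_excess_le_doubleComm`, `re_doubleComm_le`). [folklore] -/
theorem offHalf_core (hL : 3 ≤ L) {μ c₀ : ℝ} (hμ : 0 < μ) (hc₀ : 0 < c₀)
    (hLRO : c₀ * (Fintype.card (TorusSite 3 L) : ℝ) ^ 2 ≤
      ((Hmu L 0).groundStateFunctional (∑ x : TorusSite 3 L, ∑ y : TorusSite 3 L, hop x y)).re)
    (hbig : 6 < c₀ * μ * Fintype.card (TorusSite 3 L))
    {v : TensorIndex (TorusSite 3 L) 2 → ℂ} (hv : v ∈ (Hmu L μ).groundSpace)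
    (hS : (totalSpin 1 2 : Op (TorusSite 3 L) 2) *ᵥ v = 0) : v = 0 := by
  by_contra hv0
  set H₀ : Op (TorusSite 3 L) 2 := Hmu L 0 with hH₀
  set Hμ : Op (TorusSite 3 L) 2 := Hmu L μ with hHμ
  set S3 : Op (TorusSite 3 L) 2 := totalSpin 1 2 with hS3
  set Ep : Op (TorusSite 3 L) 2 := ∑ z : TorusSite 3 L, E z with hEp
  set O : Op (TorusSite 3 L) 2 := ∑ x : TorusSite 3 L, ∑ y : TorusSite 3 L, hop x y with hO
  set N : ℝ := (Fintype.card (TorusSite 3 L) : ℝ) with hN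
  have hH₀h : H₀.IsHermitian := Hmu_isHermitian L 0
  have hHμh : Hμ.IsHermitian := Hmu_isHermitian L μ
  have hNpos : 0 < N := by
    have : 6 < c₀ * μ * N := hbig
    nlinarith [mul_pos hc₀ hμ]
  -- norms of nonzero vectors are positive
  have npos : ∀ φ : TensorIndex (TorusSite 3 L) 2 → ℂ, φ ≠ 0 → 0 < (star φ ⬝ᵥ φ).re := by
    intro φ hφ
    have hnn : 0 ≤ (star φ ⬝ᵥ φ).re := (Complex.nonneg_iff.mp (dotProduct_star_self_nonneg φ)).1
    rcases hnn.lt_or_eq with hlt | heq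
    · exact hlt
    · exfalso
      apply hφ
      apply dotProduct_star_self_eq_zero.mp
      rw [star_dotProduct_self_eq_ofReal, ← heq]
      simp
  -- the two Hamiltonians on vectors
  have hHμ_eq : ∀ φ : TensorIndex (TorusSite 3 L) 2 → ℂ,
      Hμ *ᵥ φ = H₀ *ᵥ φ - (μ : ℂ) • (S3 *ᵥ φ) := by
    intro φ
    rw [hHμ, hH₀, Hmu, Hmu, sub_mulVec, sub_mulVec, smul_mulVec, smul_mulVec, ← hS3,
      Complex.ofReal_zero, zero_smul, sub_zero]
  -- Rayleigh: E₀(μ)‖φ‖² ≤ Re⟨φ, Hμ φ⟩ ; and E₀(0)‖φ‖² ≤ Re⟨φ, H₀ φ⟩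
  have ray : ∀ (K : Op (TorusSite 3 L) 2), K.IsHermitian → ∀ φ : TensorIndex (TorusSite 3 L) 2 → ℂ,
      K.groundEnergy * (star φ ⬝ᵥ φ).re ≤ (star φ ⬝ᵥ K *ᵥ φ).re := by
    intro K hK φ
    have h := (posSemidef_sub_of_groundEnergy_le hK (le_refl _)).dotProduct_mulVec_nonneg φ
    rw [sub_mulVec, smul_mulVec, one_mulVec, dotProduct_sub, dotProduct_smul, smul_eq_mul] at h
    obtain ⟨hre, -⟩ := Complex.nonneg_iff.mp h
    rw [Complex.sub_re, Complex.re_ofReal_mul] at hre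
    linarith
  -- (b) lower bound E₀(0) ≤ E₀(μ) from the half-filled ground vector v
  have hlow : H₀.groundEnergy ≤ Hμ.groundEnergy := by
    have nv := npos v hv0
    have h1 : (star v ⬝ᵥ Hμ *ᵥ v).re = Hμ.groundEnergy * (star v ⬝ᵥ v).re := by
      rw [(mem_groundSpace_iff Hμ v).mp hv, dotProduct_smul, smul_eq_mul, Complex.re_ofReal_mul]
    have h2 := ray H₀ hH₀h v
    rw [← show Hμ *ᵥ v = H₀ *ᵥ v by rw [hHμ_eq, hS, smul_zero, sub_zero], h1] at h2
    exact le_of_mul_le_mul_right h2 nv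
  -- (c) a ground vector of H₀ with the order, an S³-eigenvector
  obtain ⟨σ, hψ0, hψO⟩ := exists_col_quad_ge hH₀h O (c₀ * N ^ 2) hLRO
  set ψ := H₀.groundProj.col σ with hψdef
  have hψmem : ψ ∈ H₀.groundSpace := groundProj_col_mem H₀ σ
  have hH₀ψ : H₀ *ᵥ ψ = (H₀.groundEnergy : ℂ) • ψ := (mem_groundSpace_iff H₀ ψ).mp hψmem
  have nψ := npos ψ hψ0
  set M : ℝ := N / 2 - (downCount σ : ℝ) with hM
  have hS3ψ : S3 *ᵥ ψ = (M : ℂ) • ψ := by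
    have hc : S3 * H₀ = H₀ * S3 := (commute_hmu_totalSpin_two L hL 0).symm.eq
    have hP := groundProj_commute_of_commute hH₀h hc
    rw [hψdef, ← mulVec_single_one, mulVec_mulVec, ← hP, ← mulVec_mulVec, hS3,
      totalSpin_two_mulVec_single, mulVec_smul]
    congr 1
    rw [hM, hN]
    push_cast
    ring
  have hψH₀ : (star ψ ⬝ᵥ H₀ *ᵥ ψ).re = H₀.groundEnergy * (star ψ ⬝ᵥ ψ).re := by
    rw [hH₀ψ, dotProduct_smul, smul_eq_mul, Complex.re_ofReal_mul]
  have hψS3 : (star ψ ⬝ᵥ S3 *ᵥ ψ).re = M * (star ψ ⬝ᵥ ψ).re := by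
    rw [hS3ψ, dotProduct_smul, smul_eq_mul, Complex.re_ofReal_mul]
  by_cases hM0 : M = 0
  · -- Case M = 0 : trial state w = S⁺_tot ψ
    set w := Ep *ᵥ ψ with hw
    have hEE : Epᴴ * Ep = O - S3 := by
      rw [hO, sum_hop_eq, ← hEp, ← hS3, add_sub_cancel_right]
    have hnw : (star w ⬝ᵥ w).re = (star ψ ⬝ᵥ O *ᵥ ψ).re := by
      rw [hw, ← star_dotProduct_conjTranspose_mul_mulVec, hEE, sub_mulVec, dotProduct_sub,
        Complex.sub_re, hψS3, hM0, zero_mul, sub_zero]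
    have hnw_ge : c₀ * N ^ 2 * (star ψ ⬝ᵥ ψ).re ≤ (star w ⬝ᵥ w).re := by rw [hnw]; exact hψO
    have nw : 0 < (star w ⬝ᵥ w).re := lt_of_lt_of_le (by positivity) hnw_ge
    have hS3w : S3 *ᵥ w = w := by
      rw [hw, mulVec_mulVec, hS3, hEp, totalSpin_two_mul_sumE, ← hEp, ← hS3, add_mulVec,
        ← mulVec_mulVec, hS3ψ, hM0, Complex.ofReal_zero, zero_smul, mulVec_zero, zero_add]
    -- energies of w
    have hwH₀ : (star w ⬝ᵥ H₀ *ᵥ w).re = (star ψ ⬝ᵥ (Epᴴ * H₀ * Ep) *ᵥ ψ).re := by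
      rw [hw, ← mulVec_mulVec, ← mulVec_mulVec, dotProduct_mulVec (star ψ) Epᴴ, ← star_mulVec]
    have hwEE : (star w ⬝ᵥ w).re = (star ψ ⬝ᵥ (Epᴴ * Ep) *ᵥ ψ).re := by
      rw [hw, star_dotProduct_conjTranspose_mul_mulVec]
    have hexc := re_excess_le_doubleComm hH₀h Ep hψmem
    have hDeq : Epᴴ * H₀ * Ep - Epᴴ * Ep * H₀ - H₀ * Ep * Epᴴ + Ep * H₀ * Epᴴ =
        Epᴴ * (H₀ * Ep - Ep * H₀) - (H₀ * Ep - Ep * H₀) * Epᴴ := by noncomm_ring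
    rw [hDeq, ← hwH₀, ← hwEE] at hexc
    have hD := re_doubleComm_le L hL ψ
    rw [← hEp, ← hH₀] at hD
    -- Rayleigh at w for Hμ
    have hray := ray Hμ hHμh w
    rw [hHμ_eq, hS3w, dotProduct_sub, dotProduct_smul, smul_eq_mul, Complex.sub_re,
      Complex.re_ofReal_mul] at hray
    -- combine (all linear from here)
    have h1 : H₀.groundEnergy * (star w ⬝ᵥ w).re ≤ Hμ.groundEnergy * (star w ⬝ᵥ w).re :=
      mul_le_mul_of_nonneg_right hlow nw.le
    have key : μ * (star w ⬝ᵥ w).re ≤ 6 * N * (star ψ ⬝ᵥ ψ).re := by linarith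
    have key2 : μ * (c₀ * N ^ 2 * (star ψ ⬝ᵥ ψ).re) ≤ 6 * N * (star ψ ⬝ᵥ ψ).re :=
      le_trans (mul_le_mul_of_nonneg_left hnw_ge hμ.le) key
    have hposNn : 0 < N * (star ψ ⬝ᵥ ψ).re := mul_pos hNpos nψ
    have h3 : (c₀ * μ * N) * (N * (star ψ ⬝ᵥ ψ).re) ≤ 6 * (N * (star ψ ⬝ᵥ ψ).re) :=
      calc (c₀ * μ * N) * (N * (star ψ ⬝ᵥ ψ).re) = μ * (c₀ * N ^ 2 * (star ψ ⬝ᵥ ψ).re) := by ring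
        _ ≤ 6 * N * (star ψ ⬝ᵥ ψ).re := key2
        _ = 6 * (N * (star ψ ⬝ᵥ ψ).re) := by ring
    have h4 := mul_lt_mul_of_pos_right hbig hposNn
    linarith
  · -- Case M ≠ 0 : ψ and its flip
    have hray1 := ray Hμ hHμh ψ
    rw [hHμ_eq, dotProduct_sub, dotProduct_smul, smul_eq_mul, Complex.sub_re, Complex.re_ofReal_mul,
      hψH₀, hψS3] at hray1
    -- the flipped vector
    set φ := (flipOp : Op (TorusSite 3 L) 2) *ᵥ ψ with hφ
    have hnφ : (star φ ⬝ᵥ φ).re = (star ψ ⬝ᵥ ψ).re := by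
      rw [hφ, star_mulVec_dotProduct_mulVec flipOp_conjTranspose_mul]
    have hH₀φ : H₀ *ᵥ φ = (H₀.groundEnergy : ℂ) • φ := by
      have hcomm : flipOp * H₀ = H₀ * flipOp := by
        have := flipOp_mul_hmu L hL 0
        rwa [neg_zero] at this
      rw [hφ, mulVec_mulVec, ← hcomm, ← mulVec_mulVec, hH₀ψ, mulVec_smul]
    have hS3φ : S3 *ᵥ φ = (-(M : ℂ)) • φ := by
      rw [hφ, mulVec_mulVec, hS3, totalSpin_two_mul_flipOp, Matrix.neg_mulVec, ← hS3,
        ← mulVec_mulVec, hS3ψ, mulVec_smul, neg_smul]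
    have hφH₀ : (star φ ⬝ᵥ H₀ *ᵥ φ).re = H₀.groundEnergy * (star ψ ⬝ᵥ ψ).re := by
      rw [hH₀φ, dotProduct_smul, smul_eq_mul, Complex.re_ofReal_mul, hnφ]
    have hφS3 : (star φ ⬝ᵥ S3 *ᵥ φ).re = -M * (star ψ ⬝ᵥ ψ).re := by
      rw [hS3φ, dotProduct_smul, smul_eq_mul, ← Complex.ofReal_neg, Complex.re_ofReal_mul, hnφ]
    have hray2 := ray Hμ hHμh φ
    rw [hHμ_eq, dotProduct_sub, dotProduct_smul, smul_eq_mul, Complex.sub_re, Complex.re_ofReal_mul,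
      hφH₀, hφS3, hnφ] at hray2
    have h1 : H₀.groundEnergy * (star ψ ⬝ᵥ ψ).re ≤ Hμ.groundEnergy * (star ψ ⬝ᵥ ψ).re :=
      mul_le_mul_of_nonneg_right hlow nψ.le
    have hA : μ * (M * (star ψ ⬝ᵥ ψ).re) ≤ 0 := by linarith
    have hB : 0 ≤ μ * (M * (star ψ ⬝ᵥ ψ).re) := by linarith
    have hz : μ * (M * (star ψ ⬝ᵥ ψ).re) = 0 := le_antisymm hA hB
    rcases mul_eq_zero.mp hz with h | h
    · linarith
    · rcases mul_eq_zero.mp h with h' | h'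
      · exact hM0 h'
      · linarith

/-- The `k`-th liminf term of the crux at `μ`, in the form `Re ω_{2k,μ}(Σ hop)/(2k)⁶` (`k ≥ 2`).
[folklore] -/
theorem orderParam_eq_re_gsf (μ : ℝ) {k : ℕ} (_hk : 2 ≤ k) [NeZero (2 * k)] :
    (∑ x ∈ halfOpenBox 3 (2 * k), ∑ y ∈ halfOpenBox 3 (2 * k),
      torusPullback (d := 3) (fun L x y => if hL : L = 0 then 0 else (haveI : NeZero L := ⟨hL⟩;
        (∑ α : Fin 2, (xxzHamiltonian 1 (torusGraph 3 L) (-1) 0 -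
          (μ : ℂ) • totalSpin 1 2).groundStateFunctional
          (siteSpin 1 x (Fin.castSucc α) * siteSpin 1 y (Fin.castSucc α))).re)) (2 * k) x y) /
      ((halfOpenBox 3 (2 * k)).card : ℝ) ^ 2 =
    ((Hmu (2 * k) μ).groundStateFunctional
      (∑ s : TorusSite 3 (2 * k), ∑ t : TorusSite 3 (2 * k), hop s t)).re /
      (((2 * k : ℕ) : ℝ) ^ 3) ^ 2 := by
  have hL0 : 2 * k ≠ 0 := NeZero.ne _
  simp only [torusPullback_apply, dif_neg hL0]
  rw [sum_sq_halfOpenBox_comp_torusProj (fun s t : TorusSite 3 (2 * k) =>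
    (∑ α : Fin 2, (Hmu (2 * k) μ).groundStateFunctional
      (siteSpin 1 s (Fin.castSucc α) * siteSpin 1 t (Fin.castSucc α))).re)]
  have hsum : (∑ s : TorusSite 3 (2 * k), ∑ t : TorusSite 3 (2 * k),
      (∑ α : Fin 2, (Hmu (2 * k) μ).groundStateFunctional
        (siteSpin 1 s (Fin.castSucc α) * siteSpin 1 t (Fin.castSucc α))).re) =
      ((Hmu (2 * k) μ).groundStateFunctional
        (∑ s : TorusSite 3 (2 * k), ∑ t : TorusSite 3 (2 * k), hop s t)).re := by
    simp only [map_sum, Complex.re_sum]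
    refine Finset.sum_congr rfl fun s _ => Finset.sum_congr rfl fun t _ => ?_
    rw [Fin.sum_univ_two, hop, map_add, Complex.add_re]
    rfl
  rw [hsum, card_halfOpenBox]
  push_cast
  ring

/-- **OFF HALF FILLING IS FORCED.** For every `μ ≠ 0` there is `L₀` such that on every even torus
of side `L ≥ L₀` NO nonzero ground vector of the crux Hamiltonian `H_{L,μ}` is half filled
(`S³_tot v = 0 → v = 0`): the KLS ground state does not survive any fixed chemical potential, so a
proof of the crux must control ground states in sectors `S³_tot ≠ 0`, where site-local reflection
positivity of the state is unavailable (`HalfFillingReflectionPositivityNarrow`). Ingredients: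
the in-tree KLS theorem quantitatively (`lroAt_zero`, `orderParam_eq_re_gsf`), the Koma–Tasaki
trial states of `offHalf_core`, and the flip `U` for `μ < 0`. [folklore] -/
theorem offHalfFilling_forced {μ : ℝ} (hμ : μ ≠ 0) :
    ∃ L₀ : ℕ, ∀ (L : ℕ) [NeZero L], L₀ ≤ L → Even L →
      ∀ v ∈ (Hmu L μ).groundSpace, (totalSpin 1 2 : Op (TorusSite 3 L) 2) *ᵥ v = 0 → v = 0 := by
  obtain ⟨f, hfpos, hf0, hfk⟩ : ∃ f : ℕ → ℝ, 0 < Filter.liminf f Filter.atTop ∧ (∀ k, 0 ≤ f k) ∧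
      ∀ k : ℕ, 2 ≤ k → ∀ [NeZero (2 * k)], f k = ((Hmu (2 * k) 0).groundStateFunctional
        (∑ s : TorusSite 3 (2 * k), ∑ t : TorusSite 3 (2 * k), hop s t)).re /
        (((2 * k : ℕ) : ℝ) ^ 3) ^ 2 := by
    have h := lroAt_zero
    unfold LROAt at h
    exact ⟨_, h, fun k => orderParam_nonneg 0 k, fun k hk _ => orderParam_eq_re_gsf 0 hk⟩
  set c₀ : ℝ := Filter.liminf f Filter.atTop / 2 with hc₀
  have hc₀pos : 0 < c₀ := by positivity
  have hev1 : ∀ᶠ k : ℕ in Filter.atTop, c₀ < f k :=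
    Filter.eventually_lt_of_lt_liminf (by linarith : c₀ < Filter.liminf f Filter.atTop)
      ⟨0, Filter.eventually_map.mpr (Filter.Eventually.of_forall fun k => hf0 k)⟩
  have hT : Filter.Tendsto (fun k : ℕ => c₀ * |μ| * ((2 * k : ℕ) : ℝ) ^ 3) Filter.atTop Filter.atTop := by
    refine Filter.Tendsto.const_mul_atTop (mul_pos hc₀pos (abs_pos.mpr hμ)) ?_
    refine (Filter.tendsto_pow_atTop (by norm_num)).comp ?_
    exact tendsto_natCast_atTop_atTop.comp (Filter.tendsto_id.const_mul_atTop' (by norm_num))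
  have hev2 : ∀ᶠ k : ℕ in Filter.atTop, 6 < c₀ * |μ| * ((2 * k : ℕ) : ℝ) ^ 3 :=
    hT.eventually_gt_atTop 6
  obtain ⟨k₀, hk₀⟩ := Filter.eventually_atTop.mp (hev1.and (hev2.and (Filter.eventually_ge_atTop 2)))
  refine ⟨2 * k₀, ?_⟩
  intro L inst hL hEven v hv hS
  obtain ⟨k, rfl⟩ := hEven.two_dvd
  obtain ⟨h1, h2, h3⟩ := hk₀ k (by omega)
  have hL3 : 3 ≤ 2 * k := by omega
  rw [hfk k h3] at h1
  have hcardN : Fintype.card (TorusSite 3 (2 * k)) = (2 * k) ^ 3 := by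
    simp [ZMod.card, Fintype.card_fin]
  have hcard : (Fintype.card (TorusSite 3 (2 * k)) : ℝ) = ((2 * k : ℕ) : ℝ) ^ 3 := by
    rw [hcardN]
    push_cast
    ring
  have hX : (0 : ℝ) < ((2 * k : ℕ) : ℝ) ^ 3 := by positivity
  have hLRO : c₀ * (Fintype.card (TorusSite 3 (2 * k)) : ℝ) ^ 2 ≤
      ((Hmu (2 * k) 0).groundStateFunctional
        (∑ s : TorusSite 3 (2 * k), ∑ t : TorusSite 3 (2 * k), hop s t)).re := by
    rw [hcard]
    rw [lt_div_iff₀ (by positivity)] at h1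
    linarith
  have hbig : 6 < c₀ * |μ| * Fintype.card (TorusSite 3 (2 * k)) := by rw [hcard]; exact h2
  rcases lt_or_gt_of_ne hμ with hneg | hpos
  · -- μ < 0 : transport along the flip to −μ > 0
    have hbig' : 6 < c₀ * (-μ) * Fintype.card (TorusSite 3 (2 * k)) := by
      rwa [abs_of_neg hneg] at hbig
    have hUv : flipOp *ᵥ v ∈ (Hmu (2 * k) (-μ)).groundSpace := by
      rw [mem_groundSpace_iff]
      have hE : (Hmu (2 * k) (-μ)).groundEnergy = (Hmu (2 * k) μ).groundEnergy := by
        rw [← flip_conj_hmu (2 * k) hL3 μ]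
        refine groundEnergy_unitary_conj (Matrix.mem_unitaryGroup_iff.mpr ?_)
        rw [star_eq_conjTranspose]
        exact flipOp_mul_conjTranspose
      rw [hE, mulVec_mulVec, ← flipOp_mul_hmu (2 * k) hL3 μ, ← mulVec_mulVec,
        (mem_groundSpace_iff _ v).mp hv, mulVec_smul]
    have hSU : (totalSpin 1 2 : Op (TorusSite 3 (2 * k)) 2) *ᵥ (flipOp *ᵥ v) = 0 := by
      rw [mulVec_mulVec, totalSpin_two_mul_flipOp, Matrix.neg_mulVec, ← mulVec_mulVec, hS,
        mulVec_zero, neg_zero]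
    have hUv0 := offHalf_core (2 * k) hL3 (by linarith : 0 < -μ) hc₀pos hLRO hbig' hUv hSU
    have hv' : v = flipOpᴴ *ᵥ (flipOp *ᵥ v) := by
      rw [mulVec_mulVec, flipOp_conjTranspose_mul, one_mulVec]
    rw [hv', hUv0, mulVec_zero]
  · have hbig' : 6 < c₀ * μ * Fintype.card (TorusSite 3 (2 * k)) := by
      rwa [abs_of_pos hpos] at hbig
    exact offHalf_core (2 * k) hL3 hpos hc₀pos hLRO hbig' hv hS

end OffHalf

end Summit.AtomisticToContinuum.BoseEinsteinCondensation.Theorems.LatticeODLROOffHalfFilling.Negative
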